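import Summits.AtomisticToContinuum.BoseEinsteinCondensation.Theorems.BECCutLineWeakDisorderWitnessTransferZeroOne
import Summits.AtomisticToContinuum.BoseEinsteinCondensation.Theorems.BECCutLineWeakDisorderWitnessTransferShellPotential
import Summits.AtomisticToContinuum.BoseEinsteinCondensation.Theorems.BECCutLineWeakDisorderWitnessTransferOccupationThreeDim
import Literature.MathematicalPhysics.QuantumManyBody.BoseGasHardSetRadial
import HarnessLib

/-!
# Route BECCutLineWeakDisorder — crux `WitnessTransfer`, line `Sketch`, stub (S9): a.s. infinite pair action, `y = 0`

Stub (S9) `stub_pairAction_ae_top_of_eq_zero`: for coincident particles `xᵢ = xⱼ` with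
`0 ∈ hardVec v` (`∫_{B(0,η)} v(|w|) dw = ∞` for all `η > 0`), `P(∫₀ᵗ v(|Bⁱ_s − Bʲ_s|) ds = ∞) ≥ 10⁻³`
for every `t > 0`: the three-dimensional Paley–Zygmund estimate (S8)
`stub_threeDim_occupation_pz` for the radial charges `gₙ = min(v, n)𝟙_{(0,√t]}` with the shell
theorem (S7) `stub_lintegral_radial_mul_inv_norm_sub_le` as potential bound, `∫ gₙ(|w|)/|w| ↑ ∞`;
then the zero-one upgrade (`…ZeroOne`).
-/

noncomputable section

open MeasureTheory ProbabilityTheory Filter Set Metric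
open scoped ENNReal NNReal Topology

namespace Summit.AtomisticToContinuum.BoseEinsteinCondensation.Theorems.CutLineWitness

open Literature.MathematicalPhysics.QuantumManyBody.BoseGas
open Literature.Probability.Process

/-! ### (S9): the pair action from a coincidence point -/

/-- `∫_{0<|w|≤R} |w|⁻¹ dw < ∞` on `ℝ³` (polar coordinates: `σ(S²) ∫₀ᴿ r dr ≤ σ(S²) R²`). [folklore] -/
theorem lintegral_indicator_mul_inv_norm_lt_top (R : ℝ) :
    ∫⁻ w : Space, indicator (Ioc 0 R) (fun _ => (1 : ℝ≥0∞)) ‖w‖ * ENNReal.ofReal (‖w‖⁻¹) < ⊤ := by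
  have hF : Measurable fun r : ℝ => indicator (Ioc 0 R) (fun _ => (1 : ℝ≥0∞)) r * ENNReal.ofReal r⁻¹ :=
    (measurable_const.indicator measurableSet_Ioc).mul (ENNReal.measurable_ofReal.comp measurable_inv)
  have h := Literature.Analysis.Calculus.lintegral_radial_eq
    (fun r : ℝ => indicator (Ioc 0 R) (fun _ => (1 : ℝ≥0∞)) r * ENNReal.ofReal r⁻¹) hF
  rw [h]
  refine ENNReal.mul_lt_top toSphere_univ_lt_top ?_
  have hle : ∫⁻ r in Ioi (0 : ℝ), indicator (Ioc 0 R) (fun _ => (1 : ℝ≥0∞)) r * ENNReal.ofReal r⁻¹ *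
      ENNReal.ofReal (r ^ 2) ≤ ∫⁻ r in Ioi (0 : ℝ), indicator (Ioc 0 R) (fun _ => ENNReal.ofReal R) r := by
    refine lintegral_mono fun r => ?_
    by_cases hr : r ∈ Ioc 0 R
    · rw [indicator_of_mem hr, indicator_of_mem hr, one_mul, ← ENNReal.ofReal_mul (by
        rw [inv_nonneg]; exact hr.1.le)]
      refine ENNReal.ofReal_le_ofReal ?_
      rw [pow_two, ← mul_assoc, inv_mul_cancel₀ hr.1.ne', one_mul]
      exact hr.2
    · simp [indicator_of_notMem hr]
  refine hle.trans_lt ?_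
  rw [lintegral_indicator measurableSet_Ioc, setLIntegral_const]
  refine ENNReal.mul_lt_top ENNReal.ofReal_lt_top ?_
  rw [Measure.restrict_apply measurableSet_Ioc]
  exact (measure_mono Set.inter_subset_left).trans_lt measure_Ioc_lt_top

/-- **Uniform positive probability at a coincidence point.** If `0` is a hard point of `v`,
`xᵢ = xⱼ` (`i ≠ j`) and `t > 0`, then `P(A_t = ∞) ≥ 10⁻³` ((S7), (S8) with
`g = min(v, n)𝟙_{(0,√t]}`, `n → ∞`). [folklore] -/
theorem measure_pairAction_top_ge_of_eq {N : ℕ} {v : ℝ → ℝ≥0∞} (hv : Measurable v) {X : Config N}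
    {i j : Fin N} (hij : i ≠ j) (hz : (0 : Space) ∈ hardVec v) (hX : X i = X j) {t : ℝ}
    (ht : 0 < t) :
    ENNReal.ofReal (1 / 1000) ≤ wienerPaths N {ω | ∫⁻ r in Set.Ioc 0 t,
      v (dist (worldLine X ω r.toNNReal i) (worldLine X ω r.toNNReal j)) = ⊤} := by
  haveI := Literature.Probability.RandomPlanarGeometry.isProbabilityMeasure_preWienerMeasure'
  haveI : IsProbabilityMeasure (wienerPaths N) := by unfold wienerPaths; infer_instance
  set st := Real.sqrt t with hst
  have hst0 : 0 < st := Real.sqrt_pos.2 ht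
  set A : PathSpace N → ℝ≥0∞ := fun ω => ∫⁻ r in Set.Ioc 0 t,
    v (dist (worldLine X ω r.toNNReal i) (worldLine X ω r.toNNReal j)) with hA
  have hAm : Measurable A := measurable_pairAction hv X i j t
  -- the truncated radial charges `gₙ = min(v, n) 𝟙_{(0, √t]}`
  set g : ℕ → ℝ → ℝ≥0∞ := fun n r => indicator (Ioc 0 st) (fun r => min (v r) (n : ℝ≥0∞)) r with hg
  have hgm : ∀ n, Measurable (g n) := fun n => (hv.min measurable_const).indicator measurableSet_Ioc
  have hgsupp : ∀ n r, Real.sqrt t < r → g n r = 0 := fun n r hr => by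
    simp only [hg]; rw [indicator_of_notMem (fun h => (not_lt.2 h.2) hr)]
  have hgle : ∀ n r, g n r ≤ v r := fun n r => (indicator_le_self _ _ _).trans (min_le_left _ _)
  have hgmono : ∀ {a b : ℕ}, a ≤ b → ∀ r, g a r ≤ g b r := fun hab r =>
    indicator_le_indicator (min_le_min_left _ (by exact_mod_cast hab))
  have hgn : ∀ n r, g n r ≤ (n : ℝ≥0∞) * indicator (Ioc 0 st) (fun _ => (1 : ℝ≥0∞)) r := by
    intro n r
    by_cases hr : r ∈ Ioc 0 st
    · simp only [hg, indicator_of_mem hr, mul_one]; exact min_le_right _ _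
    · simp only [hg, indicator_of_notMem hr]; exact zero_le
  -- their potentials at the origin `mₙ = ∫ gₙ(|w|)/|w|`
  set m : ℕ → ℝ≥0∞ := fun n => ∫⁻ w : Space, g n ‖w‖ * ENNReal.ofReal (‖w‖⁻¹) with hm
  have hmmono : Monotone m := fun a b hab => lintegral_mono fun w => mul_le_mul_left (hgmono hab _) _
  have hmT : ∀ n, m n ≠ ⊤ := by
    intro n
    refine (lt_of_le_of_lt ?_ (ENNReal.mul_lt_top (ENNReal.natCast_lt_top n)
      (lintegral_indicator_mul_inv_norm_lt_top st))).ne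
    rw [← lintegral_const_mul' _ _ (ENNReal.natCast_ne_top n)]
    exact lintegral_mono fun w => by rw [← mul_assoc]; exact mul_le_mul_left (hgn n _) _
  -- `sup mₙ = ∞`
  have h1 : ∀ n, ENNReal.ofReal st⁻¹ * ∫⁻ w : Space, g n ‖w‖ ≤ m n := by
    intro n
    rw [← lintegral_const_mul' _ _ ENNReal.ofReal_ne_top]
    refine lintegral_mono fun w => ?_
    by_cases hw : ‖w‖ ∈ Ioc 0 st
    · rw [mul_comm]
      exact mul_le_mul_right (ENNReal.ofReal_le_ofReal (inv_anti₀ hw.1 hw.2)) _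
    · simp only [hg, indicator_of_notMem hw, mul_zero, zero_mul, le_refl]
  have h2 : ⨆ n, ∫⁻ w : Space, g n ‖w‖ = ∫⁻ w : Space, indicator (Ioc 0 st) v ‖w‖ := by
    rw [← lintegral_iSup (fun n => show Measurable (fun w : Space => g n ‖w‖) from
      (hgm n).comp measurable_norm) (fun a b hab w => hgmono hab _)]
    refine lintegral_congr fun w => ?_
    by_cases hw : ‖w‖ ∈ Ioc 0 st
    · simp only [hg, indicator_of_mem hw]
      refine le_antisymm (iSup_le fun n => min_le_left _ _) ?_
      by_cases hvw : v ‖w‖ = ⊤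
      · rw [hvw]; simp only [top_le_iff, min_eq_right le_top]; exact ENNReal.iSup_natCast
      · obtain ⟨n, hn⟩ := ENNReal.exists_nat_gt hvw
        exact le_iSup_of_le n (by rw [min_eq_left hn.le])
    · simp only [hg, indicator_of_notMem hw, ciSup_const]
  have h3 : ∫⁻ w : Space, indicator (Ioc 0 st) v ‖w‖ = ⊤ := by
    refine top_unique ?_
    have hball : ballIntegral v 0 st = ⊤ := hz st hst0
    rw [← hball]
    unfold ballIntegral
    have hsplit : ball (0 : Space) st ⊆ (ball (0 : Space) st \ {0}) ∪ {0} := by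
      rw [Set.sdiff_union_self]; exact subset_union_left
    refine (lintegral_mono_set hsplit).trans ((lintegral_union_le _ _ _).trans ?_)
    rw [setLIntegral_measure_zero _ _ (measure_singleton _), add_zero,
      ← lintegral_indicator (measurableSet_ball.diff (measurableSet_singleton _))]
    refine lintegral_mono fun w => ?_
    by_cases hw : w ∈ ball (0 : Space) st \ {0}
    · have hn : ‖w‖ ∈ Ioc 0 st :=
        ⟨norm_pos_iff.2 hw.2, (mem_ball_zero_iff.1 hw.1).le⟩
      rw [indicator_of_mem hw, indicator_of_mem hn]
    · rw [indicator_of_notMem hw]; exact zero_le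
  have hmsup : ⨆ n, m n = ⊤ := by
    refine top_unique ?_
    calc (⊤ : ℝ≥0∞) = ENNReal.ofReal st⁻¹ * ⨆ n, ∫⁻ w : Space, g n ‖w‖ := by
          rw [h2, h3, ENNReal.mul_top (by simp [hst0])]
      _ = ⨆ n, ENNReal.ofReal st⁻¹ * ∫⁻ w : Space, g n ‖w‖ := ENNReal.mul_iSup _ _
      _ ≤ ⨆ n, m n := iSup_mono h1
  obtain ⟨n₀, hn₀⟩ := lt_iSup_iff.1 (hmsup.symm ▸ ENNReal.zero_lt_top : (0 : ℝ≥0∞) < ⨆ n, m n)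
  have hm0 : ∀ k, m (n₀ + k) ≠ 0 := fun k => (hn₀.trans_le (hmmono (Nat.le_add_right _ _))).ne'
  -- (S7) + (S8) at level `n₀ + k`
  have hstep : ∀ k, ENNReal.ofReal (1 / 1000) ≤ wienerPaths N {ω | m (n₀ + k) / 1000 ≤ A ω} := by
    intro k
    have hpot : ∀ᵐ x : Space, ∫⁻ w : Space, g (n₀ + k) ‖w‖ * ENNReal.ofReal (‖w - x‖⁻¹) ≤
        ENNReal.ofReal 1 * m (n₀ + k) := by
      filter_upwards [stub_lintegral_radial_mul_inv_norm_sub_le (g (n₀ + k)) (hgm _)] with x hx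
      rwa [ENNReal.ofReal_one, one_mul]
    have h8 := stub_threeDim_occupation_pz (N := N) hij hX ht (hgm (n₀ + k)) (hgsupp _) (hm0 k)
      (hmT _) rfl (K := 1) le_rfl hpot
    rw [mul_one] at h8
    refine h8.trans (measure_mono fun ω hω => ?_)
    exact (show m (n₀ + k) / 1000 ≤ _ from hω).trans
      (setLIntegral_mono' measurableSet_Ioc fun s _ => hgle _ _)
  -- pass to `A = ⊤`
  set cn : ℕ → ℝ≥0∞ := fun k => m (n₀ + k) / 1000 with hcn
  have hcn_mono : Monotone cn := fun a b hab => by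
    simp only [hcn]; gcongr; exact hmmono (by omega)
  have hcn_sup : ⨆ k, cn k = ⊤ := by
    simp only [hcn]
    rw [← ENNReal.iSup_div]
    have : ⨆ k, m (n₀ + k) = ⊤ := top_unique (hmsup ▸ iSup_le fun n =>
      le_iSup_of_le n (hmmono (Nat.le_add_left _ _)))
    rw [this, ENNReal.top_div_of_ne_top (by norm_num)]
  have hsub : (⋂ k, {ω | cn k ≤ A ω}) ⊆ {ω | A ω = ⊤} := by
    intro ω hω
    simp only [mem_iInter, mem_setOf_eq] at hω ⊢
    by_contra hne
    obtain ⟨k, hk⟩ := lt_iSup_iff.1 ((lt_top_iff_ne_top.2 hne).trans_eq hcn_sup.symm)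
    exact (lt_irrefl _) ((hω k).trans_lt hk)
  have hinter : wienerPaths N (⋂ k, {ω | cn k ≤ A ω}) = ⨅ k, wienerPaths N {ω | cn k ≤ A ω} :=
    Antitone.measure_iInter (fun a b hab ω hω => (hcn_mono hab).trans hω)
      (fun k => (measurableSet_le measurable_const hAm).nullMeasurableSet) ⟨0, measure_ne_top _ _⟩
  calc ENNReal.ofReal (1 / 1000) ≤ ⨅ k, wienerPaths N {ω | cn k ≤ A ω} := le_iInf hstep
    _ = wienerPaths N (⋂ k, {ω | cn k ≤ A ω}) := hinter.symm
    _ ≤ wienerPaths N {ω | A ω = ⊤} := measure_mono hsub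

/-- **(S9)** For coincident particles `xᵢ = xⱼ` (`i ≠ j`) with `0 ∈ hardVec v` and `T > 0`, the
pair action is a.s. infinite ((S7), (S8) with `g = min(v, n)𝟙_{(0,√T]}`, `n → ∞`, Blumenthal
(S4)). [folklore] -/
theorem stub_pairAction_ae_top_of_eq_zero {N : ℕ} {v : ℝ → ℝ≥0∞} (hv : Measurable v)
    {X : Config N} {i j : Fin N} (hij : i ≠ j) (hz : (0 : Space) ∈ hardVec v) (hy : X i = X j)
    {T : ℝ} (hT : 0 < T) :
    ∀ᵐ ω ∂wienerPaths N, ∫⁻ s in Set.Ioc 0 T,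
      v (dist (worldLine X ω s.toNNReal i) (worldLine X ω s.toNNReal j)) = ⊤ :=
  pairAction_ae_top_of_uniform_pos hv X i j (p := ENNReal.ofReal (1 / 1000)) (by simp)
    (T₀ := 1) one_pos (fun t ht => measure_pairAction_top_ge_of_eq hv hij hz hy ht.1) hT

end Summit.AtomisticToContinuum.BoseEinsteinCondensation.Theorems.CutLineWitness

end
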